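import Literature.Computability.QuantumComplexity.BQP
import Literature.Computability.QuantumComplexity.JonesInBQPProofs
import HarnessLib

/-!
# `BQPOver G = BQP` from the promise-class form `PromiseBQPOver G = PromiseBQP`

Sibling proof file of `QuantumComplexity/BQP.lean` for the named fact
`Literature.Computability.QuantumComplexity.BQPOver_eq_BQP` (quantum-advantage.S26, independence of
the finite universal gate set; Bernstein–Vazirani 1997, §8; Dawson–Nielsen 2006, Thm. 1;
Nielsen–Chuang 2010, §4.5.3 and App. 3). The tree states gate-set independence twice, with
IDENTICAL hypotheses (finite encodable alphabet, unitary gates with polynomial-time computable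
entries, inverse-closed, universal at the placement level):

* for languages, `BQPOver_eq_BQP : … → BQPOver G = BQP` (`BQP.lean`);
* for promise problems, `PromiseBQPOver_eq_PromiseBQP : … → PromiseBQPOver G = PromiseBQP`
  (`JonesInBQPProofs.lean`, the form consumed by the AJL assembly
  `ajl_jonesApproxProblem_mem_PromiseBQP_of_steps`).

This file PROVES that the language form is a corollary of the promise form
(`BQPOver_eq_BQP_of_promise`), so that a single discharge of `PromiseBQPOver_eq_PromiseBQP`
closes both: a language `L` is in `BQPOver G` iff its promise problem with trivial promise
`ofLanguage L = ⟨L, Lᶜ⟩` is in `PromiseBQPOver G` (`ofLanguage_mem_PromiseBQPOver_iff`, the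
`G`-parametric form of the tree's `ofLanguage_mem_PromiseBQP_iff`; Goldreich 2006, §1.1:
"languages are promise problems with the trivial promise"; Watrous 2009, §III.2: `BQP` is the
class of languages whose trivial-promise problems lie in `PromiseBQP`), i.e.
`BQPOver G = ofLanguage ⁻¹' (PromiseBQPOver G)` (`BQPOver_eq_preimage_ofLanguage`), and preimages
of equal sets are equal (`BQPOver_eq_BQP_of_promiseBQPOver_eq`).

No definition and no named fact is introduced (net debt delta `0`); everything here is proved.

## References

* E. Bernstein, U. Vazirani, *Quantum complexity theory*, SIAM J. Comput. 26 (1997) 1411–1473,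
  §8 [BernsteinVazirani1997].
* C. M. Dawson, M. A. Nielsen, *The Solovay–Kitaev algorithm*, QIC 6 (2006), Thm. 1
  [DawsonNielsen2006].
* J. Watrous, *Quantum computational complexity*, in: Encyclopedia of Complexity and Systems
  Science, Springer 2009, §III.1–III.2 (BQP, PromiseBQP) [Watrous2009].
* O. Goldreich, *On promise problems: a survey*, in: Theoretical Computer Science, Essays in
  Memory of Shimon Even, LNCS 3895 (2006), §1.1 [Goldreich2006].
-/

noncomputable section

namespace Literature.Computability.QuantumComplexity

open _root_.Computability Complexity Cryptography

variable {G : QGateSet} [Encodable G.Op]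

/-- Unfolding lemma for `BQPOver G` with the thresholds `2/3` and `1/3` (`BQPOver G` is
`BQPWith G (1/3)`, and `1 - 1/3 = 2/3`); the `G`-parametric form of `ClassBQP.mem_BQP_iff`.
[cite: BernsteinVazirani1997, Def. 8] -/
theorem mem_BQPOver_iff {L : Language Bool} :
    L ∈ BQPOver G ↔ ∃ F : QCircuitFamily G, F.IsOracleFree ∧ F.IsUniform ∧
      ∀ x, (x ∈ L → 2 / 3 ≤ F.acceptProbOn 0 x) ∧ (x ∉ L → F.acceptProbOn 0 x ≤ 1 / 3) := by
  simp only [BQPOver, mem_BQPWith_iff]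
  norm_num

/-- `BQP` is `BQPOver cliffordT` (definitional). [cite: BernsteinVazirani1997, Def. 8] -/
theorem BQPOver_cliffordT : BQPOver cliffordT = BQP := rfl

/-- **A language is in `BQPOver G` iff its trivial-promise problem is in `PromiseBQPOver G`**
(the `G`-parametric form of `ofLanguage_mem_PromiseBQP_iff`): both say that one polynomial-time
uniform oracle-free family over `G` accepts the members of `L` with probability `≥ 2/3` and the
members of `Lᶜ` with probability `≤ 1/3`. [cite: Watrous2009, §III.2] [cite: Goldreich2006, §1.1] -/
theorem ofLanguage_mem_PromiseBQPOver_iff {L : Language Bool} :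
    PromiseProblem.ofLanguage L ∈ PromiseBQPOver G ↔ L ∈ BQPOver G := by
  rw [mem_BQPOver_iff]
  simp only [PromiseBQPOver, Set.mem_setOf_eq, PromiseProblem.yes_ofLanguage,
    PromiseProblem.no_ofLanguage]
  refine exists_congr fun F => and_congr_right fun _ => and_congr_right fun _ => ?_
  exact ⟨fun h x => ⟨h.1 x, fun hx => h.2 x hx⟩,
    fun h => ⟨fun x => (h x).1, fun x hx => (h x).2 hx⟩⟩

/-- `BQPOver G` is the preimage of `PromiseBQPOver G` under `L ↦ ⟨L, Lᶜ⟩`.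
[cite: Watrous2009, §III.2] -/
theorem BQPOver_eq_preimage_ofLanguage :
    BQPOver G = PromiseProblem.ofLanguage ⁻¹' PromiseBQPOver G := by
  ext L
  exact ofLanguage_mem_PromiseBQPOver_iff.symm

/-- In particular `BQP = ofLanguage ⁻¹' PromiseBQP`. [cite: Watrous2009, §III.2] -/
theorem BQP_eq_preimage_ofLanguage :
    BQP = PromiseProblem.ofLanguage ⁻¹' PromiseBQP := by
  ext L
  exact ofLanguage_mem_PromiseBQP_iff.symm

/-- **Pointwise transfer**: if `PromiseBQPOver G = PromiseBQP` then `BQPOver G = BQP` (equal sets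
have equal preimages under `ofLanguage`). [cite: Watrous2009, §III.2] -/
theorem BQPOver_eq_BQP_of_promiseBQPOver_eq (h : PromiseBQPOver G = PromiseBQP) :
    BQPOver G = BQP := by
  ext L
  rw [← ofLanguage_mem_PromiseBQPOver_iff, h, ofLanguage_mem_PromiseBQP_iff]

/-- **Gate-set independence of `BQP` from gate-set independence of `PromiseBQP`.** The named fact
`BQPOver_eq_BQP` (`BQP.lean`, quantum-advantage.S26: for a finite gate set `G` with unitary gates
whose entries are polynomial-time computable, inverse-closed and universal at the placement level,
`BQPOver G = BQP`; Bernstein–Vazirani 1997 §8, Dawson–Nielsen 2006 Thm. 1) follows from the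
promise-class form `PromiseBQPOver_eq_PromiseBQP` (`JonesInBQPProofs.lean`, same hypotheses) by
the pointwise transfer `BQPOver_eq_BQP_of_promiseBQPOver_eq`. Hence one discharge of the promise
form closes both facts: `BQPOver_eq_BQP_holds := BQPOver_eq_BQP_of_promise ‹_›`.
[cite: BernsteinVazirani1997, §8] [cite: DawsonNielsen2006, Thm. 1] [cite: Watrous2009, §III.1–III.2] -/
theorem BQPOver_eq_BQP_of_promise (h : PromiseBQPOver_eq_PromiseBQP) : BQPOver_eq_BQP := by
  intro G _ _ hU huniv hinv hcomp
  exact BQPOver_eq_BQP_of_promiseBQPOver_eq (h G hU huniv hinv hcomp)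

end Literature.Computability.QuantumComplexity
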